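import Summits.NavierStokesRegularity.FluidComputer.BlockQuadReach
import Summits.NavierStokesRegularity.FluidComputer.BlockReachCalculus

/-!
# Fluid computer, block design — RIGIDITY: an inhabited residue pins the design field

HONEST FRAMING: low prior, high value-of-information experiment on Tao's machine paradigm; NOT a
claim that NS blows up. This file proves NOTHING about blow-up and does NOT claim that any residue
of this lane holds. It is a STRUCTURAL fact about the re-typed residue `OpenReachBound 𝒟 P F U ε`
of `BlockQuadReach.lean` ("along every true mild trajectory, while the block-`n` readout is in `U`
and the junk is below budget, the readout has a right derivative `W` with `‖unit n • W - F
(readout)‖ ≤ ε`"), valid for EVERY design field `F`, working region `U` and level `ε`.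

WHAT IS PROVED. (§1, calculus, extends `BlockReachCalculus.lean`) For every true `H¹⁰_df`-mild
Navier–Stokes solution from a clean design state `recon n (A, B) = A√E_n ψ_n + B√E_{n+1} ψ_{n+1}`
the readout `t ↦ read n (u t)` has right derivative at `t = 0` equal to the explicit TWO-MODE
GALERKIN–NAVIER–STOKES FIELD `nsVF n (A,B) = (-Λ_n A + Re⟨B(a,a),ψ_n⟩/√E_n, -Λ_{n+1} B +
Re⟨B(a,a),ψ_{n+1}⟩/√E_{n+1})`, `a = recon n (A,B)`, `Λ_m = viscRate 𝒟 m ≥ 4π²` (heat semigroup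
diagonal on the modes — cross pairings `⟨e^{tΔ}ψ_i, ψ_j⟩ = 0` by disjoint Fourier supports — and
the Duhamel term differentiated at `0`). (§2, RIGIDITY) `OpenReachBound.norm_unit_smul_nsVF_sub_le`:
an inhabited `OpenReachBound 𝒟 P F U ε` forces `‖unit n • nsVF n p - F p‖ ≤ ε` at EVERY `p ∈ U`
and every block `n` — the design field is determined up to `ε` on the whole working region (test
the law at `t = 0` on the clean state `recon n p`, zero junk; right derivatives are unique).
(§3) On the clean axes `nsVF n (A,0) = (-Λ_n A, A² E_n κ_n/√E_{n+1})` and `nsVF n (0,B) =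
(B² E_{n+1} κ'_n/√E_n, -Λ_{n+1} B)`, with the FORWARD coefficient `κ_n = Re⟨B(ψ_n,ψ_n), ψ_{n+1}⟩`
(`fwdCoef`) and the BACKSCATTER coefficient `κ'_n = Re⟨B(ψ_{n+1},ψ_{n+1}), ψ_n⟩` (`backCoef`); so on
any `U` containing the two clean rays an inhabited residue forces EXACT identities on a design
field of the lane's axis shape: input damping `γ = unit n · Λ_n`, output damping `γ' = unit n ·
Λ_{n+1}`, coupling `k = unit n · E_n κ_n/√E_{n+1}`, and `κ'_n = 0` when `F`'s input component is
at most linear on the output ray. (§4) All four at once for the damped gate (β3′a) of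
`BlockReachViscous.lean`, `dampedQuadVF k η γ γ' (a,b) = (-kηab - γa, ka² - γ'b)`. [folklore]

HONEST READING. (1) This SHARPENS the lane's idea-bound items, it does not discharge them: for the
damped gate, (β3) becomes "the clock IS the viscous clock, `unit n = γ/Λ_n` for all `n`", and (β1)
becomes the checkable identities "`κ'_n(𝒟) = 0` and `k = unit n E_n κ_n(𝒟)/√E_{n+1}` for all `n`"
on the wavelet data `𝒟` — which this file neither verifies nor expects of a generic admissible `𝒟`.
(2) Away from the clean states (junk `> 0`) the residue keeps its genuine PDE content (interaction
with the junk modes); nothing here touches it, nor the design-level theorems of `BlockQuad*`, bp1's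
reach layer, or the whole-tick residue `OpenIdeaBound`. (3) The no-go of `BlockReachViscous.lean`
is the special case `F = quadVF` (`γ = 0 ≠ unit n Λ_n`); this file does not import it.
-/

noncomputable section

open MeasureTheory Set Filter Topology Metric
open scoped ENNReal NNReal

namespace Summit.NavierStokesRegularity.FluidComputer

open Literature.Analysis.FluidPDE Literature.Analysis.FluidPDE.Tao2016
open Literature.Analysis.FluidPDE.FluidComputer
open Literature.Analysis.FunctionSpaces (eFourierSobolevNorm)
open Summit.NavierStokesRegularity.NavierStokesRegularity.Theorems.FluidComputer
open Summit.NavierStokesRegularity.NavierStokesRegularity.Theorems.PerpetualPumpEulerTypeIGlue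
  (eulerForm_smul_smul)

namespace BlockDesign
/-! ### §1. The readout derivative at a general clean design state -/
section Calculus

variable (𝒟 : CascadeWaveletData 1 1) (S : CascadeSpecs)

/-- Cross pairings vanish under the heat flow: `⟨e^{tΔ}ψ_i, ψ_j⟩ = 0` for `i ≠ j` (the heat
semigroup is a Fourier multiplier; the modes have disjoint Fourier supports).
[cite: Tao2016AveragedNS, §4 Lemma 4.1] -/
theorem pairing_heat_mode_of_ne {i j : ℕ} (hij : i ≠ j) (t : ℝ) :
    pairing (heat t (mode 𝒟 i)) (mode 𝒟 j) = 0 := by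
  unfold mode
  rw [pairing_heat_eq_integral]
  refine (integral_congr_ae ?_).trans (integral_zero _ _)
  filter_upwards [𝒟.fourierFn_cascadeWavelet_eq_zero two_pos' 0 (i : ℤ),
    𝒟.fourierFn_cascadeWavelet_eq_zero two_pos' 0 (j : ℤ),
    fourierFn_neg_eq_conj3 (isReal_cascadeWavelet 1 (𝒟.ψ 0) (j : ℤ))] with ξ hi hj hneg
  rw [hneg]
  by_cases h : ξ ∈ freqRegion 𝒟 0 (i : ℤ)
  · have hne : ((0 : Fin 1), (i : ℤ)) ≠ ((0 : Fin 1), (j : ℤ)) := fun h' =>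
      hij (by exact_mod_cast (Prod.mk.inj h').2)
    simp [hj (𝒟.not_mem_freqRegion_of_ne one_pos hne h), cdot]
  · simp [hi h, cdot]

/-- `⟨e^{tΔ} recon n p, ψ_m⟩ = ⟨recon n p, ψ_m⟩ · ⟨e^{tΔ}ψ_m, ψ_m⟩`: the heat flow of a design state
pairs with each mode through that mode only. [folklore] -/
theorem pairing_heat_recon_mode (n m : ℕ) (p : ℝ × ℝ) (t : ℝ) :
    pairing (heat t (recon 𝒟 S n p)) (mode 𝒟 m) =
      coef 𝒟 m (recon 𝒟 S n p) * pairing (heat t (mode 𝒟 m)) (mode 𝒟 m) := by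
  rw [coef_recon]
  unfold recon
  rw [pairing_heat_left, pairing_add_left, pairing_smul_left, pairing_smul_left,
    ← pairing_heat_left, ← pairing_heat_left]
  by_cases h1 : n = m
  · subst h1
    rw [pairing_heat_mode_of_ne 𝒟 (by omega : n + 1 ≠ n) t]
    simp
  · rw [pairing_heat_mode_of_ne 𝒟 h1 t]
    by_cases h2 : n + 1 = m
    · subst h2
      simp
    · rw [pairing_heat_mode_of_ne 𝒟 h2 t]
      simp [h1, h2]

/-- The TWO-MODE GALERKIN–NAVIER–STOKES FIELD of the pair `(ψ_n, ψ_{n+1})` in readout coordinates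
(physical time): `nsVF n (A,B) = (-Λ_n A + Re⟨B(a,a),ψ_n⟩/√E_n, -Λ_{n+1} B + Re⟨B(a,a),ψ_{n+1}⟩/
√E_{n+1})`, `a = recon n (A,B)`. [folklore] -/
def nsVF (n : ℕ) (p : ℝ × ℝ) : ℝ × ℝ :=
  (-(viscRate 𝒟 n * p.1) +
      (eulerForm (recon 𝒟 S n p) (recon 𝒟 S n p) (mode 𝒟 n)).re / Real.sqrt (S.Emin n),
    -(viscRate 𝒟 (n + 1) * p.2) +
      (eulerForm (recon 𝒟 S n p) (recon 𝒟 S n p) (mode 𝒟 (n + 1))).re /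
        Real.sqrt (S.Emin (n + 1)))

/-- The block coefficient `⟨u t, ψ_m⟩` of a true mild trajectory from the clean design state
`recon n p` has right derivative `⟨recon n p, ψ_m⟩ · (-Λ_m) + ⟨B(a,a), ψ_m⟩` at `t = 0`.
[folklore] -/
theorem hasDerivWithinAt_coef_clean (n m : ℕ) (p : ℝ × ℝ) {S' : ℝ} (hS' : 0 < S')
    {u : ℝ → L2C} (hu : IsMildSolutionFor eulerForm (recon 𝒟 S n p) (Ico 0 S') u) :
    HasDerivWithinAt (fun t => coef 𝒟 m (u t))
      (coef 𝒟 m (recon 𝒟 S n p) * (((-viscRate 𝒟 m : ℝ)) : ℂ) +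
        eulerForm (recon 𝒟 S n p) (recon 𝒟 S n p) (mode 𝒟 m)) (Ici 0) 0 := by
  have hψ10 : MemH10df (mode 𝒟 m) := 𝒟.memH10df_cascadeWavelet two_pos' 0 (m : ℤ)
  have ha : MemH10df (recon 𝒟 S n p) := memH10df_recon 𝒟 S n _
  have hT₁ : 0 < S' / 2 := by positivity
  have hsub : Icc 0 (S' / 2) ⊆ Ico 0 S' := fun t ht => ⟨ht.1, lt_of_le_of_lt ht.2 (by linarith)⟩
  have hv : ContinuousInH10On (Icc 0 (S' / 2)) u := hu.2.1.mono hsub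
  have hfin : ∀ s ∈ Icc 0 (S' / 2), eFourierSobolevNorm 10 (u s) < ⊤ :=
    fun s hs => (hu.1 s (hsub hs)).1
  obtain ⟨M, hM⟩ := hv.exists_bound hfin
  have hMenn : ∀ s ∈ Icc 0 (S' / 2), eFourierSobolevNorm 10 (u s) ≤ ENNReal.ofReal M := by
    intro s hs
    rw [← ENNReal.ofReal_toReal (hfin s hs).ne]
    exact ENNReal.ofReal_le_ofReal (hM s hs)
  have hu0 : u 0 = recon 𝒟 S n p := initial_eq hu ⟨le_rfl, hS'⟩ ha
  have hD := hasDerivWithinAt_duhamel_zero hT₁ hv hMenn (mode 𝒟 m)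
  rw [hu0] at hD
  have hg : HasDerivWithinAt (fun t => coef 𝒟 m (recon 𝒟 S n p) *
      pairing (heat t (mode 𝒟 m)) (mode 𝒟 m) +
      ∫ s in (0:ℝ)..t, eulerForm (u s) (u s) (heat (t - s) (mode 𝒟 m)))
      (coef 𝒟 m (recon 𝒟 S n p) * (((-viscRate 𝒟 m : ℝ)) : ℂ) +
        eulerForm (recon 𝒟 S n p) (recon 𝒟 S n p) (mode 𝒟 m)) (Ici 0) 0 :=
    ((hasDerivWithinAt_pairing_heat_mode 𝒟 m).const_mul _).add hD
  have hcoef : ∀ t ∈ Ico 0 S', coef 𝒟 m (u t) = coef 𝒟 m (recon 𝒟 S n p) *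
      pairing (heat t (mode 𝒟 m)) (mode 𝒟 m) +
      ∫ s in (0:ℝ)..t, eulerForm (u s) (u s) (heat (t - s) (mode 𝒟 m)) := by
    intro t ht
    rw [coef, hu.2.2 t ht (mode 𝒟 m) hψ10, pairing_heat_recon_mode]
  exact ((hg.mono Ico_subset_Ici_self).congr (fun t ht => hcoef t ht) (hcoef 0 ⟨le_rfl, hS'⟩))
    |>.mono_of_mem_nhdsWithin (Ico_mem_nhdsGE hS')

/-- `t ↦ Re (f t) / c` has derivative `Re f' / c`. [folklore] -/
theorem hasDerivWithinAt_re_div_const {f : ℝ → ℂ} {f' : ℂ} {s : Set ℝ} {x : ℝ}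
    (h : HasDerivWithinAt f f' s x) (c : ℝ) :
    HasDerivWithinAt (fun t => (f t).re / c) (f'.re / c) s x :=
  (Complex.reCLM.hasFDerivAt.comp_hasDerivWithinAt x h).div_const c

/-- **The readout of a true Navier–Stokes trajectory through a clean design state moves, at that
instant, with the two-mode Galerkin–Navier–Stokes field**: for EVERY `H¹⁰_df`-mild solution `u`
from `recon n p`, `t ↦ read n (u t)` has right derivative `nsVF n p` at `t = 0`. [folklore] -/
theorem hasDerivWithinAt_read_clean (n : ℕ) (p : ℝ × ℝ) {S' : ℝ} (hS' : 0 < S')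
    {u : ℝ → L2C} (hu : IsMildSolutionFor eulerForm (recon 𝒟 S n p) (Ico 0 S') u) :
    HasDerivWithinAt (fun t => read 𝒟 S n (u t)) (nsVF 𝒟 S n p) (Ici 0) 0 := by
  have h1 := hasDerivWithinAt_coef_clean 𝒟 S n n p hS' hu
  have h2 := hasDerivWithinAt_coef_clean 𝒟 S n (n + 1) p hS' hu
  rw [coef_recon_self] at h1
  rw [coef_recon_succ] at h2
  have k1 := hasDerivWithinAt_re_div_const h1 (Real.sqrt (S.Emin n))
  have k2 := hasDerivWithinAt_re_div_const h2 (Real.sqrt (S.Emin (n + 1)))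
  obtain ⟨hE, hE'⟩ := And.intro (sqrt_Emin_pos S n).ne' (sqrt_Emin_pos S (n + 1)).ne'
  have hv1 : ((((p.1 * Real.sqrt (S.Emin n) : ℝ) : ℂ) * (((-viscRate 𝒟 n : ℝ)) : ℂ) +
      eulerForm (recon 𝒟 S n p) (recon 𝒟 S n p) (mode 𝒟 n)).re) / Real.sqrt (S.Emin n) =
      (nsVF 𝒟 S n p).1 := by
    rw [Complex.add_re, ← Complex.ofReal_mul, Complex.ofReal_re]
    simp only [nsVF]
    field_simp
  have hv2 : ((((p.2 * Real.sqrt (S.Emin (n + 1)) : ℝ) : ℂ) * (((-viscRate 𝒟 (n + 1) : ℝ)) : ℂ) +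
      eulerForm (recon 𝒟 S n p) (recon 𝒟 S n p) (mode 𝒟 (n + 1))).re) /
        Real.sqrt (S.Emin (n + 1)) = (nsVF 𝒟 S n p).2 := by
    rw [Complex.add_re, ← Complex.ofReal_mul, Complex.ofReal_re]
    simp only [nsVF]
    field_simp
  rw [hv1] at k1
  rw [hv2] at k2
  exact k1.prodMk k2

/-- `recon n (0, B) = B√E_{n+1} ψ_{n+1}`. [folklore] -/
theorem recon_snd (n : ℕ) (B : ℝ) :
    recon 𝒟 S n (0, B) = ((B * Real.sqrt (S.Emin (n + 1)) : ℝ) : ℂ) • mode 𝒟 (n + 1) := by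
  simp [recon]

/-- FORWARD transfer coefficient of the pair: `κ_n = Re⟨B(ψ_n, ψ_n), ψ_{n+1}⟩`. [folklore] -/
def fwdCoef (n : ℕ) : ℝ := (eulerForm (mode 𝒟 n) (mode 𝒟 n) (mode 𝒟 (n + 1))).re

/-- BACKSCATTER coefficient of the pair: `κ'_n = Re⟨B(ψ_{n+1}, ψ_{n+1}), ψ_n⟩`. [folklore] -/
def backCoef (n : ℕ) : ℝ := (eulerForm (mode 𝒟 (n + 1)) (mode 𝒟 (n + 1)) (mode 𝒟 n)).re

/-- On the clean input ray: `nsVF n (A, 0) = (-Λ_n A, (A√E_n)² κ_n / √E_{n+1})`. [folklore] -/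
theorem nsVF_input_ray (n : ℕ) (A : ℝ) :
    nsVF 𝒟 S n (A, 0) = (-(viscRate 𝒟 n * A),
      (A * Real.sqrt (S.Emin n)) ^ 2 * fwdCoef 𝒟 n / Real.sqrt (S.Emin (n + 1))) := by
  have h0 : eulerForm (mode 𝒟 n) (mode 𝒟 n) (mode 𝒟 n) = 0 :=
    eulerForm_self_eq_zero_of_memH10df (𝒟.memH10df_cascadeWavelet two_pos' 0 (n : ℤ))
  have h1 : eulerForm (recon 𝒟 S n (A, 0)) (recon 𝒟 S n (A, 0)) (mode 𝒟 n) = 0 := by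
    rw [recon_fst, eulerForm_smul_smul, h0, mul_zero]
  have h2 : eulerForm (recon 𝒟 S n (A, 0)) (recon 𝒟 S n (A, 0)) (mode 𝒟 (n + 1)) =
      ((((A * Real.sqrt (S.Emin n)) ^ 2 : ℝ)) : ℂ) *
        eulerForm (mode 𝒟 n) (mode 𝒟 n) (mode 𝒟 (n + 1)) := by
    rw [recon_fst, eulerForm_smul_smul, Complex.ofReal_pow]
  rw [nsVF, h1, h2, Complex.re_ofReal_mul, Complex.zero_re]
  simp [fwdCoef]

/-- On the clean output ray: `nsVF n (0, B) = ((B√E_{n+1})² κ'_n / √E_n, -Λ_{n+1} B)`. [folklore] -/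
theorem nsVF_output_ray (n : ℕ) (B : ℝ) :
    nsVF 𝒟 S n (0, B) = ((B * Real.sqrt (S.Emin (n + 1))) ^ 2 * backCoef 𝒟 n /
      Real.sqrt (S.Emin n), -(viscRate 𝒟 (n + 1) * B)) := by
  have h0 : eulerForm (mode 𝒟 (n + 1)) (mode 𝒟 (n + 1)) (mode 𝒟 (n + 1)) = 0 :=
    eulerForm_self_eq_zero_of_memH10df
      (𝒟.memH10df_cascadeWavelet two_pos' 0 ((n + 1 : ℕ) : ℤ))
  have h1 : eulerForm (recon 𝒟 S n (0, B)) (recon 𝒟 S n (0, B)) (mode 𝒟 (n + 1)) = 0 := by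
    rw [recon_snd, eulerForm_smul_smul, h0, mul_zero]
  have h2 : eulerForm (recon 𝒟 S n (0, B)) (recon 𝒟 S n (0, B)) (mode 𝒟 n) =
      ((((B * Real.sqrt (S.Emin (n + 1))) ^ 2 : ℝ)) : ℂ) *
        eulerForm (mode 𝒟 (n + 1)) (mode 𝒟 (n + 1)) (mode 𝒟 n) := by
    rw [recon_snd, eulerForm_smul_smul, Complex.ofReal_pow]
  rw [nsVF, h1, h2, Complex.re_ofReal_mul, Complex.zero_re]
  simp [backCoef]

end Calculus

/-! ### §2. Rigidity: an inhabited residue determines the design field up to `ε` -/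
variable {𝒟 : CascadeWaveletData 1 1} {S : CascadeSpecs} {P : Params S}
variable {F : ℝ × ℝ → ℝ × ℝ} {U : Set (ℝ × ℝ)} {ε : ℝ}

/-- **RIGIDITY.** If `OpenReachBound 𝒟 P F U ε` is inhabited, then at every point `p` of the
working region and every block `n`, `‖unit n • nsVF n p - F p‖ ≤ ε`: the law tested at `t = 0`
on the true trajectory from the clean design state `recon n p` (readout `p`, zero junk), whose
readout derivative IS `nsVF n p` (§1) and is unique within `[0, ∞)`. [folklore] -/
theorem OpenReachBound.norm_unit_smul_nsVF_sub_le (H : OpenReachBound 𝒟 P F U ε) (n : ℕ)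
    {p : ℝ × ℝ} (hp : p ∈ U) : ‖H.unit n • nsVF 𝒟 S n p - F p‖ ≤ ε := by
  have ha : MemH10df (recon 𝒟 S n p) := memH10df_recon 𝒟 S n _
  obtain ⟨T, hT, u, hu⟩ := h10MildTheory_holds.localExistence _ ha
  have hu0 : u 0 = recon 𝒟 S n p := initial_eq hu ⟨le_rfl, hT⟩ ha
  have hread : read 𝒟 S n (u 0) = p := by rw [hu0, read_recon]
  have hjunk : junk 𝒟 P n (u 0) < ENNReal.ofReal (H.jbar * Real.sqrt (S.Emin n)) := by
    rw [hu0, junk_recon]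
    exact ENNReal.ofReal_pos.2 (mul_pos (P.jrun_pos.trans H.jrun_lt_jbar) (sqrt_Emin_pos S n))
  obtain ⟨W, hW, hWε⟩ := H.defect n _ T u hu 0 le_rfl hT (hread ▸ hp) hjunk
  have hEq : W = nsVF 𝒟 S n p :=
    (uniqueDiffOn_Ici (0 : ℝ) 0 (Set.mem_Ici.2 le_rfl)).eq_deriv _ hW
      (hasDerivWithinAt_read_clean 𝒟 S n p hT hu)
  rw [hread, hEq] at hWε
  exact hWε

/-- Rigidity, input component. [folklore] -/
theorem OpenReachBound.abs_fst_le (H : OpenReachBound 𝒟 P F U ε) (n : ℕ) {p : ℝ × ℝ}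
    (hp : p ∈ U) : |H.unit n * (nsVF 𝒟 S n p).1 - (F p).1| ≤ ε := by
  have h := (norm_fst_le _).trans (H.norm_unit_smul_nsVF_sub_le n hp)
  simpa [Real.norm_eq_abs] using h

/-- Rigidity, output component. [folklore] -/
theorem OpenReachBound.abs_snd_le (H : OpenReachBound 𝒟 P F U ε) (n : ℕ) {p : ℝ × ℝ}
    (hp : p ∈ U) : |H.unit n * (nsVF 𝒟 S n p).2 - (F p).2| ≤ ε := by
  have h := (norm_snd_le _).trans (H.norm_unit_smul_nsVF_sub_le n hp)
  simpa [Real.norm_eq_abs] using h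

/-! ### §3. Exact identities forced on a design field of the lane's axis shape -/
/-- A linear function bounded on a ray is zero: `(∀ A ≥ A₀, |q A| ≤ c) → q = 0`. [folklore] -/
theorem eq_zero_of_abs_mul_le_of_ray {q A₀ c : ℝ} (h : ∀ A : ℝ, A₀ ≤ A → |q * A| ≤ c) : q = 0 := by
  by_contra hq
  have hq' : 0 < |q| := abs_pos.2 hq
  have h2 : |c| / |q| + 1 ≤ max A₀ (|c| / |q| + 1) := le_max_right _ _
  have hA0 : 0 ≤ max A₀ (|c| / |q| + 1) := le_trans (by positivity) h2
  have h1 := h _ (le_max_left A₀ (|c| / |q| + 1))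
  rw [abs_mul, abs_of_nonneg hA0] at h1
  have h3 : |q| * (|c| / |q| + 1) = |c| + |q| := by field_simp
  have h5 := mul_le_mul_of_nonneg_left h2 hq'.le
  rw [h3] at h5
  linarith [le_abs_self c]

/-- INPUT DAMPING IS PINNED: if `U` contains the clean input ray `{(A,0) : A ≥ A₀}` and the
design field's input component is `-γ A` on it, an inhabited residue forces `γ = unit n · Λ_n`
(for every `n`). [folklore] -/
theorem OpenReachBound.damping_fst_eq (H : OpenReachBound 𝒟 P F U ε) (n : ℕ) {A₀ γ : ℝ}
    (hU : ∀ A : ℝ, A₀ ≤ A → ((A, 0) : ℝ × ℝ) ∈ U)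
    (hF : ∀ A : ℝ, A₀ ≤ A → (F (A, 0)).1 = -(γ * A)) : γ = H.unit n * viscRate 𝒟 n := by
  refine eq_of_sub_eq_zero (eq_zero_of_abs_mul_le_of_ray (A₀ := A₀) (c := ε) fun A hA => ?_)
  have h := H.abs_fst_le n (hU A hA)
  rw [nsVF_input_ray, hF A hA] at h
  calc |(γ - H.unit n * viscRate 𝒟 n) * A|
      = |H.unit n * -(viscRate 𝒟 n * A) - -(γ * A)| := by congr 1; ring
    _ ≤ ε := h

/-- OUTPUT DAMPING IS PINNED: on the clean output ray `{(0,B) : B ≥ B₀} ⊆ U`, an output component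
`-γ' B` forces `γ' = unit n · Λ_{n+1}`. [folklore] -/
theorem OpenReachBound.damping_snd_eq (H : OpenReachBound 𝒟 P F U ε) (n : ℕ) {B₀ γ' : ℝ}
    (hU : ∀ B : ℝ, B₀ ≤ B → ((0, B) : ℝ × ℝ) ∈ U)
    (hF : ∀ B : ℝ, B₀ ≤ B → (F (0, B)).2 = -(γ' * B)) :
    γ' = H.unit n * viscRate 𝒟 (n + 1) := by
  refine eq_of_sub_eq_zero (eq_zero_of_abs_mul_le_of_ray (A₀ := B₀) (c := ε) fun B hB => ?_)
  have h := H.abs_snd_le n (hU B hB)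
  rw [nsVF_output_ray, hF B hB] at h
  calc |(γ' - H.unit n * viscRate 𝒟 (n + 1)) * B|
      = |H.unit n * -(viscRate 𝒟 (n + 1) * B) - -(γ' * B)| := by congr 1; ring
    _ ≤ ε := h

/-- THE COUPLING IS PINNED TO THE FORWARD COEFFICIENT: on the clean input ray, an output component
`k A²` forces `k = unit n · E_n κ_n / √E_{n+1}`. [folklore] -/
theorem OpenReachBound.coupling_eq (H : OpenReachBound 𝒟 P F U ε) (n : ℕ) {A₀ k : ℝ}
    (hU : ∀ A : ℝ, A₀ ≤ A → ((A, 0) : ℝ × ℝ) ∈ U)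
    (hF : ∀ A : ℝ, A₀ ≤ A → (F (A, 0)).2 = k * A ^ 2) :
    k = H.unit n * S.Emin n * fwdCoef 𝒟 n / Real.sqrt (S.Emin (n + 1)) := by
  have hEn : Real.sqrt (S.Emin n) ^ 2 = S.Emin n := Real.sq_sqrt (S.Emin_pos n).le
  refine eq_of_sub_eq_zero (eq_zero_of_abs_mul_le_of_ray (A₀ := max A₀ 1) (c := ε) fun A hA => ?_)
  have hA₀ : A₀ ≤ A := (le_max_left _ _).trans hA
  have hA1 : 1 ≤ A := (le_max_right _ _).trans hA
  have h := H.abs_snd_le n (hU A hA₀)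
  rw [nsVF_input_ray, hF A hA₀] at h
  have hq : H.unit n * ((A * Real.sqrt (S.Emin n)) ^ 2 * fwdCoef 𝒟 n /
      Real.sqrt (S.Emin (n + 1))) - k * A ^ 2 =
      -((k - H.unit n * S.Emin n * fwdCoef 𝒟 n / Real.sqrt (S.Emin (n + 1))) * A * A) := by
    rw [mul_pow, hEn]; ring
  rw [hq, abs_neg, abs_mul] at h
  calc |(k - H.unit n * S.Emin n * fwdCoef 𝒟 n / Real.sqrt (S.Emin (n + 1))) * A|
      ≤ |(k - H.unit n * S.Emin n * fwdCoef 𝒟 n / Real.sqrt (S.Emin (n + 1))) * A| * |A| :=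
        le_mul_of_one_le_right (abs_nonneg _) (by rwa [abs_of_nonneg (by linarith)])
    _ ≤ ε := h

/-- THE BACKSCATTER COEFFICIENT MUST VANISH: on the clean output ray `{(0,B) : B ≥ B₀} ⊆ U`, an
input component that is at most linear, `|(F (0,B)).1| ≤ C·B`, forces `κ'_n = 0`. [folklore] -/
theorem OpenReachBound.backCoef_eq_zero (H : OpenReachBound 𝒟 P F U ε) (n : ℕ) {B₀ C : ℝ}
    (hU : ∀ B : ℝ, B₀ ≤ B → ((0, B) : ℝ × ℝ) ∈ U)
    (hF : ∀ B : ℝ, B₀ ≤ B → |(F (0, B)).1| ≤ C * B) : backCoef 𝒟 n = 0 := by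
  have hEn : Real.sqrt (S.Emin (n + 1)) ^ 2 = S.Emin (n + 1) :=
    Real.sq_sqrt (S.Emin_pos (n + 1)).le
  have hun := H.unit_pos n
  have hc : 0 < H.unit n * S.Emin (n + 1) / Real.sqrt (S.Emin n) :=
    div_pos (mul_pos hun (S.Emin_pos (n + 1))) (sqrt_Emin_pos S n)
  suffices hq : H.unit n * S.Emin (n + 1) / Real.sqrt (S.Emin n) * backCoef 𝒟 n = 0 from
    (mul_eq_zero.1 hq).resolve_left hc.ne'
  refine eq_zero_of_abs_mul_le_of_ray (A₀ := max B₀ 1) (c := |ε| + |C|) fun B hB => ?_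
  have hB₀ : B₀ ≤ B := (le_max_left _ _).trans hB
  have hB1 : 1 ≤ B := (le_max_right _ _).trans hB
  have hB0 : 0 < B := by linarith
  have h := H.abs_fst_le n (hU B hB₀)
  rw [nsVF_output_ray] at h
  have hq : H.unit n * ((B * Real.sqrt (S.Emin (n + 1))) ^ 2 * backCoef 𝒟 n /
      Real.sqrt (S.Emin n)) =
      (H.unit n * S.Emin (n + 1) / Real.sqrt (S.Emin n) * backCoef 𝒟 n * B) * B := by
    rw [mul_pow, hEn]; ring
  rw [hq] at h
  -- `|x B - f| ≤ ε` and `|f| ≤ C B` give `|x| B ≤ ε + C B ≤ (|ε| + |C|) B`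
  have h1 : |H.unit n * S.Emin (n + 1) / Real.sqrt (S.Emin n) * backCoef 𝒟 n * B| * B ≤
      (|ε| + |C|) * B := by
    have h2 := abs_sub_abs_le_abs_sub
      (H.unit n * S.Emin (n + 1) / Real.sqrt (S.Emin n) * backCoef 𝒟 n * B * B) ((F (0, B)).1)
    rw [abs_mul _ B, abs_of_pos hB0] at h2
    have h3 := hF B hB₀
    have e1 : ε ≤ |ε| * B := by
      have := mul_le_mul_of_nonneg_left hB1 (abs_nonneg ε)
      linarith [le_abs_self ε]
    have e2 : C * B ≤ |C| * B := mul_le_mul_of_nonneg_right (le_abs_self C) hB0.le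
    linarith
  exact le_of_mul_le_mul_right h1 hB0

/-! ### §4. The damped quadratic gate (β3′a) -/
/-- The DAMPED quadratic gate proposed in `BlockReachViscous.lean` (β3′a):
`F(a,b) = (-kηab - γa, ka² - γ'b)`. [folklore] -/
def dampedQuadVF (k η γ γ' : ℝ) (z : ℝ × ℝ) : ℝ × ℝ :=
  (-(k * η * z.1 * z.2) - γ * z.1, k * z.1 ^ 2 - γ' * z.2)

/-- **All four constants of the damped gate are pinned by an inhabited residue** on any working
region containing the two clean rays: `γ = unit n Λ_n`, `γ' = unit n Λ_{n+1}`,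
`k = unit n E_n κ_n / √E_{n+1}` and `κ'_n = 0`, for EVERY block `n` (so in particular the clock
must be the viscous clock `unit n = γ / Λ_n`). Not a claim that such a residue holds. [folklore] -/
theorem OpenReachBound.dampedQuad_constants {k η γ γ' : ℝ}
    (H : OpenReachBound 𝒟 P (dampedQuadVF k η γ γ') U ε) (n : ℕ) {A₀ B₀ : ℝ}
    (hUin : ∀ A : ℝ, A₀ ≤ A → ((A, 0) : ℝ × ℝ) ∈ U)
    (hUout : ∀ B : ℝ, B₀ ≤ B → ((0, B) : ℝ × ℝ) ∈ U) :
    γ = H.unit n * viscRate 𝒟 n ∧ γ' = H.unit n * viscRate 𝒟 (n + 1) ∧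
      k = H.unit n * S.Emin n * fwdCoef 𝒟 n / Real.sqrt (S.Emin (n + 1)) ∧
        backCoef 𝒟 n = 0 :=
  ⟨H.damping_fst_eq n hUin fun A _ => by simp [dampedQuadVF],
    H.damping_snd_eq n hUout fun B _ => by simp [dampedQuadVF],
    H.coupling_eq n hUin fun A _ => by simp [dampedQuadVF],
    H.backCoef_eq_zero n (C := 0) hUout fun B _ => by simp [dampedQuadVF]⟩

/-- The instance on the loaded region `{a² + ηb² > 2}` (`η ≥ 1/2`), which contains the clean rays
`A ≥ 2` and `B ≥ 3`. [folklore] -/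
theorem OpenReachBound.dampedQuad_constants_loaded {k η γ γ' : ℝ} (hη : 1 / 2 ≤ η)
    (H : OpenReachBound 𝒟 P (dampedQuadVF k η γ γ') (loadedRegion η) ε) (n : ℕ) :
    γ = H.unit n * viscRate 𝒟 n ∧ γ' = H.unit n * viscRate 𝒟 (n + 1) ∧
      k = H.unit n * S.Emin n * fwdCoef 𝒟 n / Real.sqrt (S.Emin (n + 1)) ∧
        backCoef 𝒟 n = 0 := by
  refine H.dampedQuad_constants n (A₀ := 2) (B₀ := 3) (fun A hA => ?_) (fun B hB => ?_) <;>
    (show 2 < pairEnergy η _; unfold pairEnergy; nlinarith)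

end BlockDesign

end Summit.NavierStokesRegularity.FluidComputer
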